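import Literature.NumberTheory.DiophantineGeometry.ShuteFourSquarefulMoment

/-!
# Shute (2021), §3: the fourth moment in the regime `X ≤ Y^{2/3}` (Cauchy–Schwarz in `x₁`)

Fourth companion to `ShuteFourSquareful.lean` (named facts `Shute2021_prop32` = Shute's Prop. 3.2
and `Shute2021_prop31` = Prop. 3.1, both recorded as CLAIMS: the printed proof of the fourth-moment
bound `N(X, Y) ≪_ε X^{2+ε} Y^{8/3+ε}` behind them is incomplete, see the module docstring of
`ShuteFourSquareful.lean`, section Status), after `ShuteFourSquarefulHolder.lean`,
`ShuteFourSquarefulCounting.lean` and `ShuteFourSquarefulMoment.lean`.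

`ShuteFourSquarefulMoment.lean` proves `N(X, Y) ≪_ε X^{2+ε} Y^{3+ε}` by ONE Cauchy–Schwarz in the
colour `y₁` followed by the divisor bound. Here we run the same argument with the colour `x₁`
instead (the monochromatic equation is then `x₁²(y₁³ − y₁'³) = x₃²y₃³ − x₃'²y₃'³`, and
`a³ − b³ = n ≠ 0` has at most `4τ(|n|)` solutions because `a − b ∣ n` and, given `a − b`, the
equation is quadratic in `b`), which gives the mirror bound

* `Shute2021.fourthMoment_le_cube_sq`: `∀ ε > 0, ∃ C > 0, ∀ X Y ≥ 1, N(X, Y) ≤ C X^{3+ε} Y^{2+ε}`,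

hence `N(X, Y) ≪_ε X^{2+ε} Y^{2+ε} min(X, Y)` (`Shute2021.fourthMoment_le_min`) and, in
particular, the PRINTED exponent in the regime `X³ ≤ Y²`:

* `Shute2021.fourthMoment_le_of_cube_le_sq`:
  `∀ ε > 0, ∃ C > 0, ∀ X Y ≥ 1, X³ ≤ Y² → N(X, Y) ≤ C X^{2+ε} Y^{8/3+ε}`.

Consequently Shute's Prop. 3.2 is EQUIVALENT to the fourth-moment bound in the complementary
("long `x`") regime `Y² < X³` alone
(`Shute2021.Shute2021_prop32_iff_fourthMoment_le_of_sq_lt_cube`), which is where the gap in the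
printed proof lies: every Cauchy–Schwarz over a colour with `K` values costs the factor `K` on the
`≍ X²Y²` diagonal solutions, so the two available colourings give `X²Y² · min(X, Y)` and nothing
better, whereas `8/3` needs the saving `min(X, Y) / Y^{2/3}` when `X > Y^{2/3}`.

## The assembly (mirror of `ShuteFourSquarefulMoment.lean`)

With `P = pts X Y`, `T = C_δ (2X²Y³)^δ`, `δ = ε/6`: `N(X, Y) ≤ (2X+1) · K'` where
`K' = #{x₁ = x₁', val p₁ − val p₃ = val p₁' − val p₃'} = Σ_t G'(t)` over `t = (p₃, p₃')`;
diagonal `t` (`val p₃ = val p₃'`) have `G'(t) ≤ #P` (`x₁ = x₁'` and `x₁²y₁³ = x₁²y₁'³` force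
`y₁ = y₁'`) and there are `≤ 4 #P T` of them; off-diagonal `t` have `G'(t) ≤ 2T · 4T`
(`x₁ ∣ m`, then `a³ − b³ = m/x₁²`). So `K' ≤ 12 #P² T²` and
`N(X, Y) ≤ 3X · 12 · (9XY)² T² ≤ 2916 C_δ² 2^{ε/3} X^{3+ε} Y^{2+ε}`.

## References

* A. Shute, *Sums of four squareful numbers*, arXiv:2104.06966 (2021), §3, proof of Prop. 3.2
  (the fourth moment `N(X, Y)`; "the trivial estimate for the divisor function"; the two
  Cauchy–Schwarz inequalities in `x` and in `y`). [Shute2021]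
* G. H. Hardy, E. M. Wright, *An Introduction to the Theory of Numbers*, 6th ed. (OUP 2008),
  Thm 315 (divisor bound), vendored in `Literature/NumberTheory/Sieve/DivisorBound.lean`.
  [HardyWright2008]
-/

noncomputable section

open Finset

namespace Literature.NumberTheory.DiophantineGeometry

namespace Shute2021

/-! ### Divisor counting for `a³ − b³ = n` and `x² (a³ − b³) = m` -/

section CountingX

/-- For `n ≠ 0`, at most `2 · 2τ(|n|)` pairs `(a, b)` in a product of finite sets of integers
satisfy `a³ − b³ = n`: `d = a − b` is a signed divisor of `n`, and for fixed `d` the equation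
`(b + d)³ − b³ = n` is quadratic in `b` with the two roots `b₀`, `−b₀ − d`. [folklore] -/
theorem card_filter_cube_sub_cube_le (S T : Finset ℤ) {n : ℤ} (hn : n ≠ 0) :
    #{r ∈ S ×ˢ T | r.1 ^ 3 - r.2 ^ 3 = n} ≤ 2 * (2 * tau n) := by
  set F : Finset (ℤ × ℤ) := {r ∈ S ×ˢ T | r.1 ^ 3 - r.2 ^ 3 = n} with hF
  have himg : F.image (fun r => r.1 - r.2) ⊆ intDivisors n := by
    intro d hd
    obtain ⟨r, hr, rfl⟩ := mem_image.1 hd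
    have h := (mem_filter.1 hr).2
    exact mem_intDivisors hn ⟨r.1 ^ 2 + r.1 * r.2 + r.2 ^ 2, by linear_combination -h⟩
  have hfib : ∀ d ∈ F.image (fun r => r.1 - r.2), #{r ∈ F | r.1 - r.2 = d} ≤ 2 := by
    intro d _
    rcases ({r ∈ F | r.1 - r.2 = d} : Finset (ℤ × ℤ)).eq_empty_or_nonempty with h | ⟨r₀, hr₀⟩
    · rw [h]; simp
    · obtain ⟨hr₀F, hd₀⟩ := mem_filter.1 hr₀
      have h₀ := (mem_filter.1 hr₀F).2
      have e₀ : r₀.1 = r₀.2 + d := by linarith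
      have h₀' : (r₀.2 + d) ^ 3 - r₀.2 ^ 3 = n := by rw [← e₀]; exact h₀
      calc #{r ∈ F | r.1 - r.2 = d} ≤ #({r₀, (-r₀.2, -r₀.1)} : Finset (ℤ × ℤ)) := by
            refine card_le_card fun r hr => ?_
            obtain ⟨hrF, hd⟩ := mem_filter.1 hr
            have h := (mem_filter.1 hrF).2
            have e : r.1 = r.2 + d := by linarith
            have h' : (r.2 + d) ^ 3 - r.2 ^ 3 = n := by rw [← e]; exact h
            have hd0 : d ≠ 0 := by
              rintro rfl
              rw [add_zero, sub_self] at h'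
              exact hn h'.symm
            have key : (3 * d) * ((r.2 - r₀.2) * (r.2 + r₀.2 + d)) = 0 := by
              linear_combination h' - h₀'
            rcases mul_eq_zero.1 key with h1 | h1
            · exact absurd h1 (mul_ne_zero three_ne_zero hd0)
            · rcases mul_eq_zero.1 h1 with h2 | h2
              · have : r = r₀ := Prod.ext (by linarith) (by linarith)
                rw [this]; exact mem_insert_self _ _
              · have : r = (-r₀.2, -r₀.1) := Prod.ext (by simp only; linarith) (by simp only; linarith)
                rw [this]; exact mem_insert_of_mem (mem_singleton_self _)
        _ ≤ 2 := (card_insert_le _ _).trans (by simp)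
  calc #F ≤ 2 * #(F.image fun r => r.1 - r.2) := Finset.card_le_mul_card_image _ _ hfib
    _ ≤ 2 * #(intDivisors n) := Nat.mul_le_mul_left 2 (card_le_card himg)
    _ ≤ 2 * (2 * tau n) := Nat.mul_le_mul_left 2 (card_intDivisors_le n)

/-- For `m ≠ 0` and finite sets `R ∌ 0`, `S`, `T` of integers, at most `2τ(|m|) · (2 · 2τ(|m|))`
triples `(x, a, b) ∈ R × S × T` satisfy `x² (a³ − b³) = m` (`x ∣ m`, then `a³ − b³ = m / x²`).
[folklore] -/
theorem card_filter_sq_mul_cube_sub_cube_le (R S T : Finset ℤ) (hR : ∀ x ∈ R, x ≠ 0) {m : ℤ}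
    (hm : m ≠ 0) :
    #{w ∈ R ×ˢ (S ×ˢ T) | w.1 ^ 2 * (w.2.1 ^ 3 - w.2.2 ^ 3) = m} ≤
      2 * tau m * (2 * (2 * tau m)) := by
  rw [card_filter_product_left,
    ← sum_filter_of_ne (p := fun x : ℤ => x ∣ m) (fun x _ hne => ?_)]
  · calc ∑ x ∈ R.filter (· ∣ m), #{r ∈ S ×ˢ T | x ^ 2 * (r.1 ^ 3 - r.2 ^ 3) = m}
        ≤ ∑ x ∈ R.filter (· ∣ m), 2 * (2 * tau m) := by
          refine sum_le_sum fun x hx => ?_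
          have hx0 : x ≠ 0 := hR x (mem_filter.1 hx).1
          rcases ({r ∈ S ×ˢ T | x ^ 2 * (r.1 ^ 3 - r.2 ^ 3) = m} : Finset (ℤ × ℤ)).eq_empty_or_nonempty
            with h | ⟨r₀, hr₀⟩
          · rw [h]; simp
          · set d : ℤ := r₀.1 ^ 3 - r₀.2 ^ 3 with hd
            have hdm : x ^ 2 * d = m := (mem_filter.1 hr₀).2
            have hd0 : d ≠ 0 := by rintro h0; rw [h0, mul_zero] at hdm; exact hm hdm.symm
            have hsub : {r ∈ S ×ˢ T | x ^ 2 * (r.1 ^ 3 - r.2 ^ 3) = m} ⊆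
                {r ∈ S ×ˢ T | r.1 ^ 3 - r.2 ^ 3 = d} := by
              intro r hr
              rw [mem_filter] at hr ⊢
              exact ⟨hr.1, mul_left_cancel₀ (pow_ne_zero 2 hx0) (hr.2.trans hdm.symm)⟩
            calc _ ≤ #{r ∈ S ×ˢ T | r.1 ^ 3 - r.2 ^ 3 = d} := card_le_card hsub
              _ ≤ 2 * (2 * tau d) := card_filter_cube_sub_cube_le S T hd0
              _ ≤ 2 * (2 * tau m) := Nat.mul_le_mul_left 2 (Nat.mul_le_mul_left 2
                  (tau_le_tau_of_dvd ⟨x ^ 2, by rw [← hdm]; ring⟩ hm))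
      _ ≤ 2 * tau m * (2 * (2 * tau m)) := by
          rw [sum_const, smul_eq_mul]
          exact Nat.mul_le_mul_right _ (card_filter_dvd_le _ hm)
  · obtain ⟨r, hr⟩ := card_ne_zero.1 hne
    have hr' : x ^ 2 * (r.1 ^ 3 - r.2 ^ 3) = m := (mem_filter.1 hr).2
    exact ⟨x * (r.1 ^ 3 - r.2 ^ 3), by linear_combination -hr'⟩

end CountingX

/-! ### One Cauchy–Schwarz in `x₁`, and the slices of the monochromatic count -/

section SlicesX

variable {X Y : ℕ}

/-- **One Cauchy–Schwarz in `x₁`**: `N(X, Y) ≤ (2X + 1) · K'(X, Y)`, where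
`K'(X, Y) = #{((p₁, p₃), (p₁', p₃')) : val p₁ − val p₃ = val p₁' − val p₃', x₁ = x₁'}` is the
monochromatic count for the colour `x₁` (written with `Shute2021.coll` and the pair map
`(p₁, p₃) ↦ (val p₁ − val p₃, x₁)`). [folklore] -/
theorem diffEnergy_le_mul_monoCountX (X Y : ℕ) :
    diffEnergy val (pts X Y) ≤ (2 * X + 1) *
      coll (pts X Y ×ˢ pts X Y) (pts X Y ×ˢ pts X Y)
        (fun q => (val q.1 - val q.2, q.1.1)) (fun q => (val q.1 - val q.2, q.1.1)) := by
  have h := coll_self_le_card_mul (pts X Y ×ˢ pts X Y) (fun q => val q.1 - val q.2)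
    (fun q => q.1.1) (Icc (-(X : ℤ)) X) fun q hq => by
      have hx := (mem_pts.1 (mem_product.1 hq).1).1.1
      exact mem_Icc.2 (abs_le.1 hx)
  have hcard : #(Icc (-(X : ℤ)) X) = 2 * X + 1 := by
    rw [Int.card_Icc, show (X : ℤ) + 1 - -(X : ℤ) = ((2 * X + 1 : ℕ) : ℤ) by push_cast; ring,
      Int.toNat_natCast]
  rw [hcard] at h
  exact h

/-- `K'(X, Y) = Σ_t G'(t)` with the slices
`G'(t) = #{(p₁, p₁') : val p₁ − val p₁' = val p₃ − val p₃', x₁ = x₁'}` at `t = (p₃, p₃')`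
(reindex `((p₁, p₃), (p₁', p₃')) ↦ ((p₁, p₁'), (p₃, p₃'))` and count fibrewise). [folklore] -/
theorem monoCountX_eq_sum (X Y : ℕ) :
    coll (pts X Y ×ˢ pts X Y) (pts X Y ×ˢ pts X Y)
        (fun q => (val q.1 - val q.2, q.1.1)) (fun q => (val q.1 - val q.2, q.1.1)) =
      ∑ t ∈ pts X Y ×ˢ pts X Y,
        #{s ∈ pts X Y ×ˢ pts X Y | val s.1 - val s.2 = val t.1 - val t.2 ∧ s.1.1 = s.2.1} := by
  unfold coll
  calc _ = #{r ∈ (pts X Y ×ˢ pts X Y) ×ˢ (pts X Y ×ˢ pts X Y) |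
        val r.1.1 - val r.1.2 = val r.2.1 - val r.2.2 ∧ r.1.1.1 = r.1.2.1} := by
        refine card_equiv (Equiv.prodProdProdComm _ _ _ _) fun r => ?_
        simp only [mem_filter, mem_product, Equiv.prodProdProdComm_apply, Prod.mk.injEq]
        constructor
        · rintro ⟨⟨⟨h1, h3⟩, h1', h3'⟩, hv, hx⟩
          exact ⟨⟨⟨h1, h1'⟩, h3, h3'⟩, by linear_combination hv, hx⟩
        · rintro ⟨⟨⟨h1, h1'⟩, h3, h3'⟩, hv, hx⟩
          exact ⟨⟨⟨h1, h3⟩, h1', h3'⟩, by linear_combination hv, hx⟩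
    _ = _ := by
        rw [card_filter_product_right]

/-- **Diagonal slices**: if `val p₃ = val p₃'` then `G'(t) ≤ #pts` (`x₁ = x₁' ≠ 0` and
`x₁²y₁³ = x₁²y₁'³` force `y₁ = y₁'`, so `p₁ = p₁'`). [folklore] -/
theorem sliceCountX_le_of_eq {t : (ℤ × ℤ) × (ℤ × ℤ)} (h0 : val t.1 = val t.2) :
    #{s ∈ pts X Y ×ˢ pts X Y | val s.1 - val s.2 = val t.1 - val t.2 ∧ s.1.1 = s.2.1} ≤
      #(pts X Y) := by
  refine card_le_card_of_injOn Prod.fst ?_ ?_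
  · intro s hs
    obtain ⟨hmem, -, -⟩ := mem_filter.1 (mem_coe.1 hs)
    exact mem_coe.2 (mem_product.1 hmem).1
  · intro s hs s' hs' heq
    obtain ⟨hmem, hv, hx⟩ := mem_filter.1 (mem_coe.1 hs)
    obtain ⟨hmem', hv', hx'⟩ := mem_filter.1 (mem_coe.1 hs')
    have hmono : StrictMono fun v : ℤ => v ^ 3 := Odd.strictMono_pow (by decide)
    -- on a diagonal slice both points of `s` coincide
    have hdiag : ∀ u : (ℤ × ℤ) × (ℤ × ℤ), u ∈ pts X Y ×ˢ pts X Y →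
        val u.1 - val u.2 = val t.1 - val t.2 → u.1.1 = u.2.1 → u.1 = u.2 := by
      intro u hu huv hux
      have hx0 : u.1.1 ≠ 0 := (mem_pts.1 (mem_product.1 hu).1).1.2
      have hval : val u.1 = val u.2 := by linear_combination huv + h0
      have hcube : u.1.1 ^ 2 * u.1.2 ^ 3 = u.1.1 ^ 2 * u.2.2 ^ 3 := by
        simpa only [val, hux] using hval
      have hy : u.1.2 = u.2.2 :=
        hmono.injective (mul_left_cancel₀ (pow_ne_zero 2 hx0) hcube)
      exact Prod.ext hux hy
    have e := hdiag s hmem hv hx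
    have e' := hdiag s' hmem' hv' hx'
    refine Prod.ext heq ?_
    rw [← e, ← e']
    exact heq

/-- **Off-diagonal slices**: if `m = val p₃ − val p₃' ≠ 0` then `G'(t) ≤ 2τ(|m|) · (2 · 2τ(|m|))`
(inject `(p₁, p₁') ↦ (x₁, y₁, y₁')` into the solutions of `x² (a³ − b³) = m`). [folklore] -/
theorem sliceCountX_le_of_ne {t : (ℤ × ℤ) × (ℤ × ℤ)} (h0 : val t.1 ≠ val t.2) :
    #{s ∈ pts X Y ×ˢ pts X Y | val s.1 - val s.2 = val t.1 - val t.2 ∧ s.1.1 = s.2.1} ≤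
      2 * tau (val t.1 - val t.2) * (2 * (2 * tau (val t.1 - val t.2))) := by
  have hm : val t.1 - val t.2 ≠ 0 := sub_ne_zero.2 h0
  calc _ ≤ #{w ∈ xdom X ×ˢ (ydom Y ×ˢ ydom Y) |
        w.1 ^ 2 * (w.2.1 ^ 3 - w.2.2 ^ 3) = val t.1 - val t.2} := by
        refine card_le_card_of_injOn (fun s => (s.1.1, (s.1.2, s.2.2))) ?_ ?_
        · intro s hs
          obtain ⟨hmem, hv, hx⟩ := mem_filter.1 (mem_coe.1 hs)
          obtain ⟨h1, h2⟩ := mem_product.1 hmem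
          refine mem_coe.2 (mem_filter.2 ⟨mem_product.2 ⟨(mem_product.1 h1).1,
            mem_product.2 ⟨(mem_product.1 h1).2, (mem_product.1 h2).2⟩⟩, ?_⟩)
          show s.1.1 ^ 2 * (s.1.2 ^ 3 - s.2.2 ^ 3) = val t.1 - val t.2
          rw [← hv]
          simp only [val]
          rw [← hx]
          ring
        · intro s hs s' hs' heq
          obtain ⟨-, -, hx⟩ := mem_filter.1 (mem_coe.1 hs)
          obtain ⟨-, -, hx'⟩ := mem_filter.1 (mem_coe.1 hs')
          simp only [Prod.mk.injEq] at heq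
          obtain ⟨e1, e2, e2'⟩ := heq
          refine Prod.ext (Prod.ext e1 e2) (Prod.ext ?_ e2')
          rw [← hx, ← hx', e1]
    _ ≤ _ := card_filter_sq_mul_cube_sub_cube_le _ _ _
        (fun x hx => (mem_filter.1 hx).2) hm

end SlicesX

/-! ### Assembly: `N(X, Y) ≤ C_ε X^{3+ε} Y^{2+ε}` -/

section RealBoundX

/-- Exponent bookkeeping for the final step: for `X, Y ≥ 1` and `ε > 0`,
`X³ Y² (2X²Y³)^{ε/3} ≤ 2^{ε/3} X^{3+ε} Y^{2+ε}`. [folklore] -/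
theorem cube_sq_mul_rpow_le {X Y ε : ℝ} (hX : 1 ≤ X) (hY : 1 ≤ Y) (hε : 0 < ε) :
    X ^ 3 * Y ^ 2 * (2 * X ^ 2 * Y ^ 3) ^ (ε / 3) ≤ 2 ^ (ε / 3) * X ^ (3 + ε) * Y ^ (2 + ε) := by
  have hX0 : 0 < X := by linarith
  have hY0 : 0 < Y := by linarith
  have e1 : (2 * X ^ 2 * Y ^ 3) ^ (ε / 3) = 2 ^ (ε / 3) * (X ^ 2) ^ (ε / 3) * (Y ^ 3) ^ (ε / 3) := by
    rw [Real.mul_rpow (by positivity) (by positivity), Real.mul_rpow (by positivity) (by positivity)]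
  have e2 : (X ^ 2) ^ (ε / 3) ≤ X ^ ε := by
    rw [← Real.rpow_two, ← Real.rpow_mul hX0.le]
    exact Real.rpow_le_rpow_of_exponent_le hX (by linarith)
  have e3 : (Y ^ 3) ^ (ε / 3) = Y ^ ε := by
    rw [show Y ^ 3 = Y ^ ((3 : ℕ) : ℝ) from (Real.rpow_natCast Y 3).symm, ← Real.rpow_mul hY0.le]
    congr 1
    push_cast
    ring
  have e4 : X ^ (3 + ε) = X ^ 3 * X ^ ε := by
    rw [Real.rpow_add hX0, show ((3 : ℝ)) = ((3 : ℕ) : ℝ) by norm_num, Real.rpow_natCast]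
  have e5 : Y ^ (2 + ε) = Y ^ 2 * Y ^ ε := by
    rw [Real.rpow_add hY0, Real.rpow_two]
  rw [e1, e3, e4, e5]
  have : 0 ≤ 2 ^ (ε / 3) * Y ^ 2 * Y ^ ε * X ^ 3 := by positivity
  calc X ^ 3 * Y ^ 2 * (2 ^ (ε / 3) * (X ^ 2) ^ (ε / 3) * Y ^ ε)
      = (2 ^ (ε / 3) * Y ^ 2 * Y ^ ε * X ^ 3) * (X ^ 2) ^ (ε / 3) := by ring
    _ ≤ (2 ^ (ε / 3) * Y ^ 2 * Y ^ ε * X ^ 3) * X ^ ε := mul_le_mul_of_nonneg_left e2 this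
    _ = 2 ^ (ε / 3) * (X ^ 3 * X ^ ε) * (Y ^ 2 * Y ^ ε) := by ring

/-- **The mirror fourth-moment bound** (one Cauchy–Schwarz in `x₁`, then the divisor bound): for
every `ε > 0` there is `C = C(ε) > 0` with `N(X, Y) ≤ C X^{3+ε} Y^{2+ε}` for all `X, Y ≥ 1`,
where `N(X, Y)` is Shute's fourth moment (`Shute2021.fourthMoment`). Together with
`Shute2021.fourthMoment_le_three` (`X^{2+ε} Y^{3+ε}`) this is what the two Cauchy–Schwarz
inequalities of the source give when used one at a time. [folklore] -/
theorem fourthMoment_le_cube_sq :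
    ∀ ε : ℝ, 0 < ε → ∃ C : ℝ, 0 < C ∧ ∀ X Y : ℕ, 1 ≤ X → 1 ≤ Y →
      (fourthMoment X Y : ℝ) ≤ C * (X : ℝ) ^ (3 + ε) * (Y : ℝ) ^ (2 + ε) := by
  intro ε hε
  obtain ⟨Cd, hCd1, hCd⟩ :=
    Literature.NumberTheory.Sieve.exists_card_divisors_le_mul_rpow (ε := ε / 6) (by positivity)
  refine ⟨2916 * Cd ^ 2 * (2 : ℝ) ^ (ε / 3), by positivity, fun X Y hX hY => ?_⟩
  have hX1 : (1 : ℝ) ≤ X := by exact_mod_cast hX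
  have hY1 : (1 : ℝ) ≤ Y := by exact_mod_cast hY
  set P := pts X Y with hP_def
  set B : ℝ := 2 * (X : ℝ) ^ 2 * (Y : ℝ) ^ 3 with hB_def
  have hXY1 : (1 : ℝ) ≤ (X : ℝ) ^ 2 * (Y : ℝ) ^ 3 := one_le_mul_of_one_le_of_one_le
    (one_le_pow₀ hX1) (one_le_pow₀ hY1)
  have hB1 : (1 : ℝ) ≤ B := by rw [hB_def]; nlinarith
  set TB : ℝ := Cd * B ^ (ε / 6) with hTB_def
  have hTB1 : 1 ≤ TB :=
    one_le_mul_of_one_le_of_one_le hCd1 (Real.one_le_rpow hB1 (by positivity))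
  -- uniform divisor bounds
  have htau : ∀ m : ℤ, m ≠ 0 → |(m : ℝ)| ≤ B → (tau m : ℝ) ≤ TB := fun m hm hmB =>
    tau_le_of_abs_le (by positivity) (by linarith) hCd hm hmB
  have hvalB : ∀ p ∈ P, |((val p : ℤ) : ℝ)| ≤ (X : ℝ) ^ 2 * (Y : ℝ) ^ 3 := fun p hp => by
    have h := abs_val_le hp
    have h' : ((|val p| : ℤ) : ℝ) ≤ (((X : ℤ) ^ 2 * (Y : ℤ) ^ 3 : ℤ) : ℝ) := by exact_mod_cast h
    push_cast at h'
    exact h'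
  have hmB : ∀ t ∈ P ×ˢ P, |((val t.1 - val t.2 : ℤ) : ℝ)| ≤ B := fun t ht => by
    obtain ⟨h1, h2⟩ := mem_product.1 ht
    push_cast
    calc |((val t.1 : ℤ) : ℝ) - val t.2| ≤ |((val t.1 : ℤ) : ℝ)| + |((val t.2 : ℤ) : ℝ)| :=
          abs_sub _ _
      _ ≤ (X : ℝ) ^ 2 * (Y : ℝ) ^ 3 + (X : ℝ) ^ 2 * (Y : ℝ) ^ 3 :=
          add_le_add (hvalB _ h1) (hvalB _ h2)
      _ = B := by rw [hB_def]; ring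
  -- the slices
  have hslice : ∀ t ∈ P ×ˢ P,
      (#{s ∈ P ×ˢ P | val s.1 - val s.2 = val t.1 - val t.2 ∧ s.1.1 = s.2.1} : ℝ) ≤
        #P * (if val t.1 = val t.2 then 1 else 0) + 8 * TB ^ 2 := by
    intro t ht
    split_ifs with h
    · have h1 : (#{s ∈ P ×ˢ P | val s.1 - val s.2 = val t.1 - val t.2 ∧ s.1.1 = s.2.1} : ℝ) ≤
          #P := by exact_mod_cast sliceCountX_le_of_eq h
      nlinarith
    · have h1 : (#{s ∈ P ×ˢ P | val s.1 - val s.2 = val t.1 - val t.2 ∧ s.1.1 = s.2.1} : ℝ) ≤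
          2 * tau (val t.1 - val t.2) * (2 * (2 * tau (val t.1 - val t.2))) := by
        exact_mod_cast sliceCountX_le_of_ne h
      have h2 := htau _ (sub_ne_zero.2 h) (hmB t ht)
      have h3 : (0 : ℝ) ≤ tau (val t.1 - val t.2) := Nat.cast_nonneg _
      nlinarith
  have hsum : (coll (P ×ˢ P) (P ×ˢ P)
        (fun q => (val q.1 - val q.2, q.1.1)) (fun q => (val q.1 - val q.2, q.1.1)) : ℝ) ≤
      #P * #{t ∈ P ×ˢ P | val t.1 = val t.2} + #(P ×ˢ P) * (8 * TB ^ 2) := by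
    rw [monoCountX_eq_sum, Nat.cast_sum]
    calc _ ≤ ∑ t ∈ P ×ˢ P, ((#P : ℝ) * (if val t.1 = val t.2 then 1 else 0) + 8 * TB ^ 2) :=
          sum_le_sum hslice
      _ = _ := by
          rw [sum_add_distrib, ← mul_sum, sum_boole, sum_const, nsmul_eq_mul]
  have hdiag : (#{t ∈ P ×ˢ P | val t.1 = val t.2} : ℝ) ≤ #P * (4 * TB) := by
    calc _ ≤ ((∑ p' ∈ P, 4 * tau (val p') : ℕ) : ℝ) := by
          exact_mod_cast card_filter_val_eq_val_le X Y
      _ = ∑ p' ∈ P, 4 * (tau (val p') : ℝ) := by push_cast; rfl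
      _ ≤ ∑ p' ∈ P, 4 * TB := sum_le_sum fun p' hp' => by
          have := htau (val p') (val_ne_zero hp')
            ((hvalB p' hp').trans (by rw [hB_def]; nlinarith))
          linarith
      _ = #P * (4 * TB) := by rw [sum_const, nsmul_eq_mul]
  have hPP : (#(P ×ˢ P) : ℝ) = #P * #P := by rw [card_product]; push_cast; ring
  have hP0 : (0 : ℝ) ≤ #P := Nat.cast_nonneg _
  have hmono : (coll (P ×ˢ P) (P ×ˢ P)
        (fun q => (val q.1 - val q.2, q.1.1)) (fun q => (val q.1 - val q.2, q.1.1)) : ℝ) ≤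
      12 * (#P : ℝ) ^ 2 * TB ^ 2 := by
    have hTB2 : TB ≤ TB ^ 2 := by nlinarith
    calc _ ≤ #P * (#P * (4 * TB)) + #P * #P * (8 * TB ^ 2) := by
          rw [← hPP]
          exact hsum.trans (by nlinarith [hdiag, hP0])
      _ = 4 * (#P : ℝ) ^ 2 * TB + 8 * (#P : ℝ) ^ 2 * TB ^ 2 := by ring
      _ ≤ 4 * (#P : ℝ) ^ 2 * TB ^ 2 + 8 * (#P : ℝ) ^ 2 * TB ^ 2 := by
          nlinarith [sq_nonneg (#P : ℝ)]
      _ = 12 * (#P : ℝ) ^ 2 * TB ^ 2 := by ring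
  have hE : (fourthMoment X Y : ℝ) ≤ (2 * X + 1) * coll (P ×ˢ P) (P ×ˢ P)
        (fun q => (val q.1 - val q.2, q.1.1)) (fun q => (val q.1 - val q.2, q.1.1)) := by
    rw [fourthMoment_eq_diffEnergy]
    exact_mod_cast diffEnergy_le_mul_monoCountX X Y
  have hPle : (#P : ℝ) ≤ 9 * X * Y := card_pts_le hX hY
  have hTB2 : TB ^ 2 = Cd ^ 2 * B ^ (ε / 3) := by
    rw [hTB_def, mul_pow, ← Real.rpow_two (B ^ (ε / 6)), ← Real.rpow_mul (by linarith)]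
    congr 2
    ring
  have hfin := cube_sq_mul_rpow_le hX1 hY1 hε
  calc (fourthMoment X Y : ℝ) ≤ (2 * X + 1) * (12 * (#P : ℝ) ^ 2 * TB ^ 2) :=
        hE.trans (mul_le_mul_of_nonneg_left hmono (by positivity))
    _ ≤ (3 * X) * (12 * (9 * X * Y) ^ 2 * TB ^ 2) := by gcongr; linarith
    _ = 2916 * Cd ^ 2 * ((X : ℝ) ^ 3 * (Y : ℝ) ^ 2 * (2 * (X : ℝ) ^ 2 * (Y : ℝ) ^ 3) ^ (ε / 3)) := by
        rw [hTB2, hB_def]; ring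
    _ ≤ 2916 * Cd ^ 2 * ((2 : ℝ) ^ (ε / 3) * (X : ℝ) ^ (3 + ε) * (Y : ℝ) ^ (2 + ε)) :=
        mul_le_mul_of_nonneg_left hfin (by positivity)
    _ = 2916 * Cd ^ 2 * (2 : ℝ) ^ (ε / 3) * (X : ℝ) ^ (3 + ε) * (Y : ℝ) ^ (2 + ε) := by ring

end RealBoundX

/-! ### Consequences: `min(X, Y)`, the regime `X³ ≤ Y²`, and the reduction of Prop. 3.2 -/

section ConsequencesX

/-- **`N(X, Y) ≪_ε X^{2+ε} Y^{2+ε} min(X, Y)`**: the two one-colour bounds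
(`fourthMoment_le_three`, colour `y₁`; `fourthMoment_le_cube_sq`, colour `x₁`) combined. This is
the diagonal-limited strength of the method: a Cauchy–Schwarz over a colour with `K` values costs
the factor `K` on the `≍ X²Y²` trivial solutions. [folklore] -/
theorem fourthMoment_le_min :
    ∀ ε : ℝ, 0 < ε → ∃ C : ℝ, 0 < C ∧ ∀ X Y : ℕ, 1 ≤ X → 1 ≤ Y →
      (fourthMoment X Y : ℝ) ≤
        C * (X : ℝ) ^ (2 + ε) * (Y : ℝ) ^ (2 + ε) * ((min X Y : ℕ) : ℝ) := by
  intro ε hε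
  obtain ⟨C₁, hC₁, h₁⟩ := fourthMoment_le_cube_sq ε hε
  obtain ⟨C₂, hC₂, h₂⟩ := fourthMoment_le_three ε hε
  refine ⟨max C₁ C₂, lt_max_of_lt_left hC₁, fun X Y hX hY => ?_⟩
  have hX0 : (0 : ℝ) < X := by exact_mod_cast hX
  have hY0 : (0 : ℝ) < Y := by exact_mod_cast hY
  have eX : (X : ℝ) ^ (3 + ε) = (X : ℝ) ^ (2 + ε) * X := by
    rw [show (3 + ε : ℝ) = (2 + ε) + 1 by ring, Real.rpow_add hX0, Real.rpow_one]
  have eY : (Y : ℝ) ^ (3 + ε) = (Y : ℝ) ^ (2 + ε) * Y := by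
    rw [show (3 + ε : ℝ) = (2 + ε) + 1 by ring, Real.rpow_add hY0, Real.rpow_one]
  rcases le_total X Y with hXY | hYX
  · rw [min_eq_left hXY]
    calc (fourthMoment X Y : ℝ) ≤ C₁ * (X : ℝ) ^ (3 + ε) * (Y : ℝ) ^ (2 + ε) := h₁ X Y hX hY
      _ = C₁ * (X : ℝ) ^ (2 + ε) * (Y : ℝ) ^ (2 + ε) * (X : ℝ) := by rw [eX]; ring
      _ ≤ max C₁ C₂ * (X : ℝ) ^ (2 + ε) * (Y : ℝ) ^ (2 + ε) * (X : ℝ) := by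
          gcongr
          exact le_max_left _ _
  · rw [min_eq_right hYX]
    calc (fourthMoment X Y : ℝ) ≤ C₂ * (X : ℝ) ^ (2 + ε) * (Y : ℝ) ^ (3 + ε) := h₂ X Y hX hY
      _ = C₂ * (X : ℝ) ^ (2 + ε) * (Y : ℝ) ^ (2 + ε) * (Y : ℝ) := by rw [eY]; ring
      _ ≤ max C₁ C₂ * (X : ℝ) ^ (2 + ε) * (Y : ℝ) ^ (2 + ε) * (Y : ℝ) := by
          gcongr
          exact le_max_right _ _

/-- `X³ ≤ Y²` gives `X ≤ Y^{2/3}` for real `X, Y ≥ 0`. [folklore] -/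
theorem le_rpow_two_thirds_of_cube_le_sq {X Y : ℝ} (hX : 0 ≤ X) (hY : 0 ≤ Y)
    (h : X ^ 3 ≤ Y ^ 2) : X ≤ Y ^ (2 / 3 : ℝ) := by
  have hX3 : (X ^ 3) ^ ((3 : ℕ) : ℝ)⁻¹ = X := Real.pow_rpow_inv_natCast hX (by norm_num)
  calc X = (X ^ 3) ^ ((3 : ℕ) : ℝ)⁻¹ := hX3.symm
    _ ≤ (Y ^ 2) ^ ((3 : ℕ) : ℝ)⁻¹ := Real.rpow_le_rpow (by positivity) h (by norm_num)
    _ = Y ^ (2 / 3 : ℝ) := by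
        rw [← Real.rpow_two, ← Real.rpow_mul hY]
        norm_num

/-- **The printed exponent holds in the regime `X³ ≤ Y²`**: for every `ε > 0` there is `C > 0`
with `N(X, Y) ≤ C X^{2+ε} Y^{8/3+ε}` for all `X, Y ≥ 1` with `X³ ≤ Y²` (from
`fourthMoment_le_cube_sq`: `X^{3+ε}Y^{2+ε} = X^{2+ε} · X · Y^{2+ε} ≤ X^{2+ε} Y^{2/3} Y^{2+ε}`).
Shute's "(the old prop)" `N(X, Y) = O(X^{2+ε}Y^{8/3+ε})` (arXiv:2104.06966, §3) asserts this for
all `X, Y`; the complementary regime `Y² < X³` is the open part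
(`Shute2021_prop32_iff_fourthMoment_le_of_sq_lt_cube`). [folklore] -/
theorem fourthMoment_le_of_cube_le_sq :
    ∀ ε : ℝ, 0 < ε → ∃ C : ℝ, 0 < C ∧ ∀ X Y : ℕ, 1 ≤ X → 1 ≤ Y → X ^ 3 ≤ Y ^ 2 →
      (fourthMoment X Y : ℝ) ≤ C * (X : ℝ) ^ (2 + ε) * (Y : ℝ) ^ (8 / 3 + ε) := by
  intro ε hε
  obtain ⟨C, hC, h⟩ := fourthMoment_le_cube_sq ε hε
  refine ⟨C, hC, fun X Y hX hY hXY => ?_⟩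
  have hX0 : (0 : ℝ) < X := by exact_mod_cast hX
  have hY0 : (0 : ℝ) < Y := by exact_mod_cast hY
  have hXY' : (X : ℝ) ^ 3 ≤ (Y : ℝ) ^ 2 := by exact_mod_cast hXY
  have hle : (X : ℝ) ≤ (Y : ℝ) ^ (2 / 3 : ℝ) := le_rpow_two_thirds_of_cube_le_sq hX0.le hY0.le hXY'
  have eX : (X : ℝ) ^ (3 + ε) = (X : ℝ) ^ (2 + ε) * X := by
    rw [show (3 + ε : ℝ) = (2 + ε) + 1 by ring, Real.rpow_add hX0, Real.rpow_one]
  have eY : (Y : ℝ) ^ (8 / 3 + ε) = (Y : ℝ) ^ (2 / 3 : ℝ) * (Y : ℝ) ^ (2 + ε) := by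
    rw [← Real.rpow_add hY0]
    congr 1
    ring
  calc (fourthMoment X Y : ℝ) ≤ C * (X : ℝ) ^ (3 + ε) * (Y : ℝ) ^ (2 + ε) := h X Y hX hY
    _ = C * (X : ℝ) ^ (2 + ε) * (X : ℝ) * (Y : ℝ) ^ (2 + ε) := by rw [eX]; ring
    _ ≤ C * (X : ℝ) ^ (2 + ε) * (Y : ℝ) ^ (2 / 3 : ℝ) * (Y : ℝ) ^ (2 + ε) := by gcongr
    _ = C * (X : ℝ) ^ (2 + ε) * (Y : ℝ) ^ (8 / 3 + ε) := by rw [eY]; ring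

/-- **Reduction of Prop. 3.2 to the long-`x` regime.** Shute's Prop. 3.2 (`Shute2021_prop32`,
equivalent to the fourth-moment bound `N(X, Y) ≪_ε X^{2+ε}Y^{8/3+ε}` for all `X, Y ≥ 1` by
`Shute2021_prop32_iff_fourthMoment_le`) is equivalent to that bound in the regime `Y² < X³` only,
the regime `X³ ≤ Y²` being settled by `fourthMoment_le_of_cube_le_sq`.
[cite: Shute2021, §3, proof of Prop. 3.2 ("(the old prop)")] -/
theorem Shute2021_prop32_iff_fourthMoment_le_of_sq_lt_cube :
    Shute2021_prop32 ↔
      ∀ ε : ℝ, 0 < ε → ∃ C : ℝ, 0 < C ∧ ∀ X Y : ℕ, 1 ≤ X → 1 ≤ Y → Y ^ 2 < X ^ 3 →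
        (fourthMoment X Y : ℝ) ≤ C * (X : ℝ) ^ (2 + ε) * (Y : ℝ) ^ (8 / 3 + ε) := by
  constructor
  · intro h ε hε
    obtain ⟨C, hC, hN⟩ := Shute2021_prop32_iff_fourthMoment_le.1 h ε hε
    exact ⟨C, hC, fun X Y hX hY _ => hN X Y hX hY⟩
  · intro h
    refine Shute2021_prop32_of_fourthMoment_le fun ε hε => ?_
    obtain ⟨C₁, hC₁, h₁⟩ := h ε hε
    obtain ⟨C₂, hC₂, h₂⟩ := fourthMoment_le_of_cube_le_sq ε hε
    refine ⟨max C₁ C₂, lt_max_of_lt_left hC₁, fun X Y hX hY => ?_⟩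
    have hmono : ∀ {C C' : ℝ}, C ≤ C' →
        C * (X : ℝ) ^ (2 + ε) * (Y : ℝ) ^ (8 / 3 + ε) ≤ C' * (X : ℝ) ^ (2 + ε) * (Y : ℝ) ^ (8 / 3 + ε) :=
      fun hCC' => by gcongr
    rcases lt_or_ge (Y ^ 2) (X ^ 3) with hlt | hle
    · exact (h₁ X Y hX hY hlt).trans (hmono (le_max_left _ _))
    · exact (h₂ X Y hX hY hle).trans (hmono (le_max_right _ _))

end ConsequencesX

end Shute2021

end Literature.NumberTheory.DiophantineGeometry
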